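import Mathlib
import Summits.ResolutionOfSingularities.ResolutionOfSingularities.Theorems.WeightedInvariantLocalWeightedDropWildMonicWCleanMulti
import Summits.ResolutionOfSingularities.ResolutionOfSingularities.Theorems.WeightedInvariantLocalWeightedDropWildMonicFlagSwapReading

/-!
# `WeightedInvariant.LocalWeightedDrop`, line `hasse-ridge-face-selection`, S3ρ sub-stub S3ρD `stub_wildMonicSurfaceDescent`:
# CLEAN REPRESENTATIVES — simultaneous `w`-cleanness for finitely many weights, and VALIDITY of the clean hypersurface flag

Crux item stmt-ResolutionOfSingularities-8899 `LocalWeightedDrop` (route `ResolutionOfSingularities/WeightedInvariant`), engine of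
the door `HypersurfaceCentreConstruction` stmt-ResolutionOfSingularities-19897.  [OURS · L1 W4.3, chain w43, res-L1-w43-stub-7 (second
seat on S3ρ under res-type-083); first deliverable of Uk-ρD1 = item (i) of res-type-083's `AxisPackageN0` (CUT 2026-08-27T09:03Z) and
the «W-clean» stage of the parent pipeline.  MODEL: S. Perlega, arXiv:2011.14443: Ch. 9 p0105 «we can assume that `f` is clean with
respect to finitely many given weighted order functions» (Lemma 5.1.8), and Prop. 7.4.5 (1) (p0093: the `ord_(x)`-, `ord_(y)`-clean
hypersurface makes the transversal flag VALID, i.e. `m`-maximal).  Nothing here is a statement of H. Hironaka's manuscript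
[claim: Hironaka2017, status: under-review]; OUR objects.]

* `wMin_ne_top_of_ne_zero` — a non-zero tuple has all `m_w` finite;
* `exists_shift_isWClean_list` — SIMULTANEOUS CLEANNESS: for a finite list of weights, one re-centring `g` (`g(0) = 0`, no `m_w` decreased,
  earlier cleanness with finite `m_w` kept) makes the position clean for all of them — or kills it (zero tuple, the fourth exit);
* `wMin_shift_le_of_isWClean_shift` — at a `w`-clean representative `shift d A g₀`, EVERY re-centring `shift d A g'` of the same position has
  `m_w ≤` (Prop. 5.1.3 through `shift_shift`);
* `isMMax_zero_of_isWClean` — hence a representative clean for `(1,0)` (if `0 ∈ E`) and `(0,1)` (if `1 ∈ E`) is a VALID `n = 0`, `h = 0`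
  flag: `IsMMax d A E g₀ 0` (item (i) of `AxisPackageN0`).
-/

set_option linter.dupNamespace false -- mandated namespace of this single-conjunct summit

noncomputable section

namespace Summit.ResolutionOfSingularities.ResolutionOfSingularities.Theorems

namespace WildMonic

open MvPowerSeries MonicDescent
open PurePowerFlag (IsN0)

variable {k : Type} [Field k] (p : ℕ) [Fact p.Prime] [CharP k p] {d : ℕ}

omit [Fact p.Prime] [CharP k p] in
/-- A NON-ZERO tuple has every `m_w` finite. -/
theorem wMin_ne_top_of_ne_zero (w : Fin 2 → ℕ) {B : Fin d → MvPowerSeries (Fin 2) k} (hB : B ≠ 0) : wMin w B ≠ ⊤ :=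
  fun h => hB (eq_zero_of_wMin_eq_top w B h)

section List

variable [PerfectRing k p]

/-- SIMULTANEOUS `w`-CLEANNESS FOR A FINITE LIST OF WEIGHTS (Perlega Prop. 5.1.5 + Lemma 5.1.8, iterated): one re-centring `g` with
`g(0) = 0`, no `m_{w′}` decreased, and every `w′`-cleanness of the start with finite `m_{w′}` kept with the same `m_{w′}`, makes the
position clean for every weight of the list — or re-centres it to the zero tuple. -/
theorem exists_shift_isWClean_list (hd : 0 < d) (A : Fin d → MvPowerSeries (Fin 2) k) (hA : ∀ j, constantCoeff (A j) = 0) :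
    ∀ ws : List (Fin 2 → ℕ), ∃ g : MvPowerSeries (Fin 2) k, constantCoeff g = 0 ∧
      (∀ w' : Fin 2 → ℕ, wMin w' A ≤ wMin w' (shift d A g)) ∧
      (((∀ w ∈ ws, IsWClean p w (shift d A g)) ∧
        ∀ w' : Fin 2 → ℕ, IsWClean p w' A → wMin w' A ≠ ⊤ → IsWClean p w' (shift d A g) ∧ wMin w' (shift d A g) = wMin w' A) ∨
        shift d A g = 0) := by
  intro ws
  induction ws with
  | nil =>
    refine ⟨0, map_zero _, fun w' => by rw [shift_zero], Or.inl ⟨fun w hw => by simp at hw, fun w' hw' _ => ?_⟩⟩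
    rw [shift_zero]; exact ⟨hw', rfl⟩
  | cons ν ws ih =>
    obtain ⟨g₁, hg₁0, hmono₁, hor₁⟩ := ih
    rcases hor₁ with ⟨hws, hkeep₁⟩ | hzero
    · by_cases hB0 : shift d A g₁ = 0
      · exact ⟨g₁, hg₁0, hmono₁, Or.inr hB0⟩
      have hB : ∀ j, constantCoeff (shift d A g₁ j) = 0 := constantCoeff_shift A hA hg₁0
      obtain ⟨g₂, hg₂0, -, hmono₂, hor₂⟩ := exists_shift_isWClean_keep p ν (shift d A g₁) hd hB
      refine ⟨g₂ + g₁, by rw [map_add, hg₁0, hg₂0, add_zero], fun w' => ?_, ?_⟩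
      · rw [← shift_shift]; exact (hmono₁ w').trans (hmono₂ w')
      rw [← shift_shift]
      rcases hor₂ with ⟨hν, hkeep₂, -⟩ | hz
      · refine Or.inl ⟨fun w hw => ?_, fun w' hw' hfin => ?_⟩
        · rcases List.mem_cons.1 hw with rfl | hmem
          · exact hν
          · exact (hkeep₂ w (hws w hmem) (wMin_ne_top_of_ne_zero w hB0)).1
        · obtain ⟨hc₁, hm₁⟩ := hkeep₁ w' hw' hfin
          obtain ⟨hc₂, hm₂⟩ := hkeep₂ w' hc₁ (by rw [hm₁]; exact hfin)
          exact ⟨hc₂, hm₂.trans hm₁⟩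
      · exact Or.inr hz
    · exact ⟨g₁, hg₁0, hmono₁, Or.inr hzero⟩

end List

/-- AT A `w`-CLEAN REPRESENTATIVE `shift d A g₀` (finite `m_w`), EVERY re-centring of the same position has `m_w ≤` (Prop. 5.1.3 of
`…WildMonicShiftOrderCases` through `shift d A g' = shift d (shift d A g₀) (g' − g₀)`). -/
theorem wMin_shift_le_of_isWClean_shift (w : Fin 2 → ℕ) (A : Fin d → MvPowerSeries (Fin 2) k) {g₀ : MvPowerSeries (Fin 2) k}
    (hclean : IsWClean p w (shift d A g₀)) (hfin : wMin w (shift d A g₀) ≠ ⊤) (g' : MvPowerSeries (Fin 2) k) :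
    wMin w (shift d A g') ≤ wMin w (shift d A g₀) := by
  have h : shift d A g' = shift d (shift d A g₀) (g' - g₀) := by rw [shift_shift, sub_add_cancel]
  rw [h]
  exact wMin_shift_le_of_isWClean w _ _ p hclean hfin

/-- VALIDITY OF THE CLEAN HYPERSURFACE (item (i) of `AxisPackageN0`; Perlega Prop. 7.4.5 (1)): if the representative `shift d A g₀` is
`(1,0)`-clean when `0 ∈ E` and `(0,1)`-clean when `1 ∈ E`, and no re-centring annihilates the position, then the `n = 0`, `h = 0` flag
of `g₀` is `m`-MAXIMAL: `IsMMax d A E g₀ 0`. -/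
theorem isMMax_zero_of_isWClean (E : Finset (Fin 2)) (A : Fin d → MvPowerSeries (Fin 2) k) {g₀ : MvPowerSeries (Fin 2) k}
    (hnz : ∀ g : MvPowerSeries (Fin 2) k, constantCoeff g = 0 → (newtonSet (shift d A g)).Nonempty)
    (hg₀ : constantCoeff g₀ = 0)
    (h10 : (0 : Fin 2) ∈ E → IsWClean p ![1, 0] (shift d A g₀)) (h01 : (1 : Fin 2) ∈ E → IsWClean p ![0, 1] (shift d A g₀)) :
    IsMMax d A E g₀ 0 := by
  intro g' hg'
  rw [mOf_of_isN0 (Or.inr rfl), mOf_of_isN0 (Or.inr rfl), flagTuple_zero_shear, flagTuple_zero_shear]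
  have hN0 := hnz g₀ hg₀
  have hN' := hnz g' hg'
  have hne0 : shift d A g₀ ≠ 0 := fun h => by
    have hempty : newtonSet (0 : Fin d → MvPowerSeries (Fin 2) k) = ∅ := (newtonSet_eq_empty_iff _).2 fun _ => rfl
    rw [h, hempty] at hN0
    exact Set.not_nonempty_empty hN0
  obtain ⟨-, h0g₀, h1g₀⟩ := wMin_eq_of_newtonSet_nonempty E (shift d A g₀) hN0
  obtain ⟨-, h0g', h1g'⟩ := wMin_eq_of_newtonSet_nonempty E (shift d A g') hN'
  have hr0 : excExp E (newtonSet (shift d A g')) 0 ≤ excExp E (newtonSet (shift d A g₀)) 0 := by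
    by_cases h0 : (0 : Fin 2) ∈ E
    · have hle := wMin_shift_le_of_isWClean_shift p ![1, 0] A (h10 h0) (wMin_ne_top_of_ne_zero _ hne0) g'
      rw [h0g' h0, h0g₀ h0] at hle
      exact_mod_cast hle
    · rw [excExp_apply_zero, excExp_apply_zero, if_neg h0, if_neg h0]
  have hr1 : excExp E (newtonSet (shift d A g')) 1 ≤ excExp E (newtonSet (shift d A g₀)) 1 := by
    by_cases h1 : (1 : Fin 2) ∈ E
    · have hle := wMin_shift_le_of_isWClean_shift p ![0, 1] A (h01 h1) (wMin_ne_top_of_ne_zero _ hne0) g'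
      rw [h1g' h1, h1g₀ h1] at hle
      exact_mod_cast hle
    · rw [excExp_apply_one, excExp_apply_one, if_neg h1, if_neg h1]
  exact Nat.add_le_add hr0 hr1

end WildMonic

end Summit.ResolutionOfSingularities.ResolutionOfSingularities.Theorems

end
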